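import Literature.NumberTheory.GaloisRepresentations.ContinuousH1
import HarnessLib

/-!
# Route ByReductionTypeAtTwo, crux `OrdKatoHalfAtTwoIso` (stmt-BirchSwinnertonDyer-19573), line
# `steinberg-fibre-at-two`: Sah's lemma relative to a subgroup, CENTRALITY ONLY INSIDE A NORMAL SUBGROUP
# (the engine of the `p = 2` replacement of the central-scalar step of the odd-prime Euler-system core)

Seat `cruxlead-stmt-BirchSwinnertonDyer-19573-g0` (LEAD PROVER, MODE LINE; HOME `run/shared/lean/pub/bsd-2adic/`).
HONEST FRAMING (cell bsd-2adic): BSD is not proved by any of this; the crux `OrdKatoHalfAtTwoIso` is not proved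
here; this file is PURE GROUP COHOMOLOGY (continuous 1-cocycles of a topological group, any coefficient ring),
with no elliptic curve in it. `--supports stmt-BirchSwinnertonDyer-19573 --as helper`.

WHY (lead's PORT-MAP `Cruxes/OrdKatoHalfAtTwoIso/PORT-MAP-stub_port.md`, site (P1)). The kernel proof of the
odd-prime core `X10.coreTheoremAOddPrime_holds` kills classes of the twisted modules `𝒯_J(E)` that vanish on
`ker ρ̄_{E,p} ⊓ Gal(ℚ̄/ℚ_∞)` by Sah's lemma with a CENTRAL SCALAR `σ₀` (`SahRel.oneCocycleClass_eq_zero_of_forall_mem_eq_zero`,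
file `Theorems/SmallImageMuTransferMuTransferX9CentralScalar.lean`: `z` central modulo `N` in the WHOLE group,
`ρ(z)` commuting with every `ρ(g)`, `ρ(z) − 1` bijective). At `p = 2` on the DD12 residue the image
`GL₂(𝔽₂) ≅ S₃` has trivial centre; the substitute is an element `σ₀ ∈ Gal(ℚ̄/ℚ_∞)` acting on `E[2]` as a
3-CYCLE (no non-zero fixed vector; tree-side supplied by the residue image lemmas of this line), which is central
modulo `N` only inside the index-`2` normal subgroup `H = ρ̄₂⁻¹(A₃)`. This file proves the corresponding
generalisation of Sah's lemma: centrality, commutation and membership of `z` are required only INSIDE a normal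
subgroup `H ⊇ N`; the price is paid by `X^H ⊆ ker(ρ(z) − 1) = 0`, which makes the inflation step trivial.

* `rho_sub_apply_of_forall_mem_eq_zero_of_mem` — Sah's cocycle identity `ρ(z)φ(h) − φ(h) = ρ(h)φ(z) − φ(z)` for
  `h ∈ H`, `z` central modulo `N` inside `H`, `φ` vanishing on `N`.
* `exists_forall_mem_apply_eq_rho_sub` — hence `φ|_H` is principal: `φ(h) = ρ(h)v − v` (`v` = the solution of
  `ρ(z)v − v = φ(z)`), when `ρ(z)` commutes with `ρ(H)` and `ρ(z) − 1` is bijective.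
* `rho_apply_eq_of_forall_mem_eq_zero` — a cocycle vanishing on a NORMAL subgroup `H` takes `ρ(H)`-invariant values.
* `oneCocycleClass_eq_zero_of_forall_mem_eq_zero_of_normal` — **the engine**: `φ` vanishing on `N ≤ H`, `H`
  normal, `z ∈ H` central modulo `N` inside `H`, `ρ(z)` commuting with `ρ(H)`, `ρ(z) − 1` bijective ⇒ `[φ] = 0`.
* `oneCocycleClass_eq_of_forall_mem_eq_of_normal` — injectivity form: two cocycles agreeing on `N` have the same class.
The case `H = ⊤` is exactly the tree's `SahRel` pair.

References: C.-H. Sah, J. Algebra 10 (1968) Prop. 2.7 (b) and its proof; J.-P. Serre, *Galois Cohomology* I §2.2,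
§5.1 (crossed homomorphisms); the tree's `SmallImageMuTransferMuTransferX9CentralScalar.lean` §1.
-/

set_option autoImplicit false
set_option linter.dupNamespace false

noncomputable section

namespace Summit.BirchSwinnertonDyer.BirchSwinnertonDyer.Theorems.SteinbergFibreAtTwo.SahRelNormal

open _root_.TopRep _root_.ContinuousCohomology Function Literature.NumberTheory.GaloisRepresentations

universe u v

variable {R : Type u} [Ring R] [TopologicalSpace R]
variable {G : Type v} [Group G] [TopologicalSpace G] [IsTopologicalGroup G]
variable {X : TopRep.{v} R G}

omit [IsTopologicalGroup G] in
/-- **Sah's cocycle identity, centrality only inside `H`.** For a continuous crossed homomorphism `φ : G → X`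
vanishing on `N`, an element `z` with `z h = h z n` (`n ∈ N`) for every `h ∈ H`, and `h ∈ H`:
`ρ(z)φ(h) − φ(h) = ρ(h)φ(z) − φ(z)`. [cite: Sah1968, Prop. 2.7 (b) and its proof, p. 60] -/
theorem rho_sub_apply_of_forall_mem_eq_zero_of_mem (φ : contOneCocycles X) (N H : Subgroup G)
    (hφN : ∀ n ∈ N, φ.1 n = 0) {z : G} (hz : ∀ h ∈ H, ∃ n ∈ N, z * h = h * z * n) {h : G}
    (hh : h ∈ H) : X.ρ z (φ.1 h) - φ.1 h = X.ρ h (φ.1 z) - φ.1 z := by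
  obtain ⟨n, hn, hzh⟩ := hz h hh
  have h1 : φ.1 (z * h) = φ.1 z + X.ρ z (φ.1 h) := φ.2 z h
  have h2 : φ.1 (h * z * n) = φ.1 h + X.ρ h (φ.1 z) := by
    rw [φ.2 (h * z) n, hφN n hn, map_zero, add_zero, φ.2 h z]
  rw [hzh, h2] at h1
  rw [sub_eq_sub_iff_add_eq_add, add_comm (X.ρ z (φ.1 h)), ← h1, add_comm]

omit [IsTopologicalGroup G] in
/-- **`φ|_H` is principal.** Under the hypotheses of `rho_sub_apply_of_forall_mem_eq_zero_of_mem`, if moreover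
`ρ(z)` commutes with `ρ(h)` for `h ∈ H` and `x ↦ ρ(z)x − x` is bijective, then with `v` the solution of
`ρ(z)v − v = φ(z)` one has `φ(h) = ρ(h)v − v` for every `h ∈ H`. [cite: Sah1968, Prop. 2.7 (b) and its proof, p. 60] -/
theorem exists_forall_mem_apply_eq_rho_sub (φ : contOneCocycles X) (N H : Subgroup G)
    (hφN : ∀ n ∈ N, φ.1 n = 0) {z : G} (hz : ∀ h ∈ H, ∃ n ∈ N, z * h = h * z * n)
    (hcomm : ∀ h ∈ H, ∀ x : X, X.ρ z (X.ρ h x) = X.ρ h (X.ρ z x))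
    (hbij : Bijective fun x : X => X.ρ z x - x) :
    ∃ v : X, ∀ h ∈ H, φ.1 h = X.ρ h v - v := by
  obtain ⟨v, hv⟩ := hbij.2 (φ.1 z)
  have hv' : X.ρ z v - v = φ.1 z := hv
  refine ⟨v, fun h hh => hbij.1 ?_⟩
  change X.ρ z (φ.1 h) - φ.1 h = X.ρ z (X.ρ h v - v) - (X.ρ h v - v)
  rw [rho_sub_apply_of_forall_mem_eq_zero_of_mem φ N H hφN hz hh, ← hv']
  simp only [map_sub]
  rw [hcomm h hh]
  abel

omit [TopologicalSpace G] [IsTopologicalGroup G] in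
/-- **A cocycle vanishing on a NORMAL subgroup takes invariant values**: if `ψ(h) = 0` for all `h ∈ H`, `H`
normal, then `ρ(h)ψ(g) = ψ(g)` for all `g ∈ G`, `h ∈ H` (expand `ψ(hg) = ψ(g·(g⁻¹hg))` both ways).
[folklore] -/
theorem rho_apply_eq_of_forall_mem_eq_zero (ψ : G → X)
    (hψ : ∀ a b : G, ψ (a * b) = ψ a + X.ρ a (ψ b)) (H : Subgroup G) (hH : H.Normal)
    (hψH : ∀ h ∈ H, ψ h = 0) (g : G) {h : G} (hh : h ∈ H) : X.ρ h (ψ g) = ψ g := by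
  have h1 : ψ (h * g) = X.ρ h (ψ g) := by rw [hψ, hψH h hh, zero_add]
  have hconj : g⁻¹ * h * g ∈ H := by
    have := hH.conj_mem h hh g⁻¹
    simpa [mul_assoc] using this
  have h2 : ψ (h * g) = ψ g := by
    have : h * g = g * (g⁻¹ * h * g) := by
      rw [mul_assoc, mul_inv_cancel_left]
    rw [this, hψ, hψH _ hconj, map_zero, add_zero]
  rw [← h1, h2]

/-- **Sah relative to a subgroup, centrality inside a normal subgroup — vanishing form (the engine).** Let
`φ : G → X` be a continuous crossed homomorphism vanishing on `N`, `H ⊇ N` a NORMAL subgroup of `G`, and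
`z ∈ H` such that `z h ∈ h z N` for all `h ∈ H`, `ρ(z)` commutes with `ρ(h)` for `h ∈ H`, and `x ↦ ρ(z)x − x` is
bijective on `X`. Then `[φ] = 0` in `H¹_cont(G, X)`. Proof: `φ|_H = ∂v` (previous lemma); `ψ := φ − ∂v` is a
crossed homomorphism vanishing on `H`, so its values are `ρ(H)`-invariant, in particular fixed by `ρ(z)`; as
`ρ(z) − 1` is injective they vanish: `φ = ∂v`. (The tree's `SahRel.oneCocycleClass_eq_zero_of_forall_mem_eq_zero` is
the case `H = ⊤`.) [cite: Sah1968, Prop. 2.7 (b) and its proof, p. 60] -/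
theorem oneCocycleClass_eq_zero_of_forall_mem_eq_zero_of_normal (φ : contOneCocycles X) (N H : Subgroup G)
    (hH : H.Normal) (hNH : N ≤ H) (hφN : ∀ n ∈ N, φ.1 n = 0) {z : G} (hzH : z ∈ H)
    (hz : ∀ h ∈ H, ∃ n ∈ N, z * h = h * z * n)
    (hcomm : ∀ h ∈ H, ∀ x : X, X.ρ z (X.ρ h x) = X.ρ h (X.ρ z x))
    (hbij : Bijective fun x : X => X.ρ z x - x) : oneCocycleClass X φ = 0 := by
  have _ := hNH
  obtain ⟨v, hv⟩ := exists_forall_mem_apply_eq_rho_sub φ N H hφN hz hcomm hbij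
  -- the corrected cochain `ψ g := φ g − (ρ g v − v)`
  set ψ : G → X := fun g => φ.1 g - (X.ρ g v - v) with hψdef
  have hρmul : ∀ (a b : G) (x : X), X.ρ (a * b) x = X.ρ a (X.ρ b x) := fun a b x => by
    rw [map_mul]; rfl
  have hψcoc : ∀ a b : G, ψ (a * b) = ψ a + X.ρ a (ψ b) := by
    intro a b
    simp only [hψdef, φ.2 a b, hρmul, map_sub]
    abel
  have hψH : ∀ h ∈ H, ψ h = 0 := fun h hh => by
    simp only [hψdef, hv h hh, sub_self]
  have hψz : ∀ g : G, X.ρ z (ψ g) = ψ g := fun g =>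
    rho_apply_eq_of_forall_mem_eq_zero ψ hψcoc H hH hψH g hzH
  have hψ0 : ∀ g : G, ψ g = 0 := fun g => by
    apply hbij.1
    change X.ρ z (ψ g) - ψ g = X.ρ z 0 - 0
    rw [hψz g, sub_self, map_zero, sub_zero]
  rw [oneCocycleClass_eq_zero_iff]
  refine ⟨v, fun g => ?_⟩
  have := hψ0 g
  rw [hψdef, sub_eq_zero] at this
  exact this

/-- **Injectivity form**: two continuous crossed homomorphisms `φ, ψ : G → X` that agree on `N` have the same
class in `H¹_cont(G, X)`, as soon as some `z ∈ H` (`H ⊇ N` normal) is central modulo `N` inside `H`, `ρ(z)`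
commutes with `ρ(H)` and `ρ(z) − 1` is bijective. [cite: Sah1968, Prop. 2.7 (b) and its proof, p. 60] -/
theorem oneCocycleClass_eq_of_forall_mem_eq_of_normal (φ ψ : contOneCocycles X) (N H : Subgroup G)
    (hH : H.Normal) (hNH : N ≤ H) (hN : ∀ n ∈ N, φ.1 n = ψ.1 n) {z : G} (hzH : z ∈ H)
    (hz : ∀ h ∈ H, ∃ n ∈ N, z * h = h * z * n)
    (hcomm : ∀ h ∈ H, ∀ x : X, X.ρ z (X.ρ h x) = X.ρ h (X.ρ z x))
    (hbij : Bijective fun x : X => X.ρ z x - x) :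
    oneCocycleClass X φ = oneCocycleClass X ψ := by
  rw [← sub_eq_zero, ← oneCocycleClass_sub]
  refine oneCocycleClass_eq_zero_of_forall_mem_eq_zero_of_normal (φ - ψ) N H hH hNH (fun n hn => ?_) hzH hz
    hcomm hbij
  change φ.1 n - ψ.1 n = 0
  rw [hN n hn, sub_self]

end Summit.BirchSwinnertonDyer.BirchSwinnertonDyer.Theorems.SteinbergFibreAtTwo.SahRelNormal

end
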